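import Mathlib
import Summits.ResolutionOfSingularities.ResolutionOfSingularities.Theses.WildQuotients
import HarnessLib

/-!
# `JordanBlockFourfold` (stmt-17942) from the `J₄` final of programme V4U

(crux stmt-ResolutionOfSingularities-15640 `WildQuotients.WildQuotientResolution`; route item
`JordanBlockFourfold` = stmt-ResolutionOfSingularities-17942; programme V4U of `L/w45c/CHAIN.md` v5
§NEXT; [OURS · L1 W4.5c] — NOT a statement of any manuscript.)

The `J₄` final of the toric-exit programme V4U has the ∀-shape used by res-L1-w45c-stub-3's
`LinearPowFour.linearCyclicQuotientFourfold_hasResolution_of_finals` (p490375):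
for fixed `p, k`, every `σ` on `k[x₁,…,xₙ]` acting by a `4 × 4` unipotent Jordan block on four
distinct coordinates `a, b, c, d` and trivially on the others has a resolvable quotient. This file
records that the route item `JordanBlockFourfold` (`n = 4`, the block on `x₀,x₁,x₂,x₃`, `p ≥ 5`,
`k` perfect) is the instance `(n; a,b,c,d) = (4; 0,1,2,3)` of that final
(`jordanBlockFourfold_of_jordanFour`), so that stmt-17942 closes by a one-liner the moment the V4U
final lands (the perfectness and `p ≥ 5` hypotheses of the item are simply not used).
-/

-- single-problem summit: the doubled namespace component `ResolutionOfSingularities` is forced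
set_option linter.dupNamespace false

noncomputable section

open MvPolynomial AlgebraicGeometry Literature.AlgebraicGeometry.Resolution

namespace Summit.ResolutionOfSingularities.ResolutionOfSingularities.Theorems.WildQuotientResolution.JordanFour

/-- **`JordanBlockFourfold` ⇐ the `J₄` final** (shape of `…_of_finals`' `hJ4`, quantified over
`p ≥ 5` and perfect `k` as in the item): instantiate at `n = 4`, `(a,b,c,d) = (0,1,2,3)`.
[OURS · L1 W4.5c] -/
theorem jordanBlockFourfold_of_jordanFour
    (hJ4 : ∀ (p : ℕ), p.Prime → 5 ≤ p → ∀ (k : Type) [Field k] [CharP k p] [PerfectField k]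
      (n : ℕ) (σ : MvPolynomial (Fin n) k ≃ₐ[k] MvPolynomial (Fin n) k) (a b c d : Fin n),
      a ≠ b → a ≠ c → a ≠ d → b ≠ c → b ≠ d → c ≠ d →
      σ (X b) = X b + X a → σ (X c) = X c + X b → σ (X d) = X d + X c →
      (∀ i, i ≠ b → i ≠ c → i ≠ d → σ (X i) = X i) →
      Scheme.HasResolution
        (Spec (.of (FixedPoints.subalgebra k (MvPolynomial (Fin n) k) (Subgroup.zpowers σ))))) :
    Summit.ResolutionOfSingularities.ResolutionOfSingularities.Theses.WildQuotients.JordanBlockFourfold := by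
  intro p hp hp5 k _ _ _ σ h0 h1 h2 h3
  refine hJ4 p hp hp5 k 4 σ 0 1 2 3 (by decide) (by decide) (by decide) (by decide) (by decide)
    (by decide) h1 h2 h3 ?_
  intro i hi1 hi2 hi3
  fin_cases i
  · exact h0
  · exact absurd rfl hi1
  · exact absurd rfl hi2
  · exact absurd rfl hi3

/-- The same reduction with the final stated for ALL fields of characteristic `p` (no perfectness)
and all primes `p` admitted by the final (`hp0 : p₀ ≤ p`, e.g. `p₀ = 5` or `p₀ = 3`). [OURS · L1 W4.5c] -/
theorem jordanBlockFourfold_of_jordanFour' (p₀ : ℕ) (hp₀ : p₀ ≤ 5)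
    (hJ4 : ∀ (p : ℕ), p.Prime → p₀ ≤ p → ∀ (k : Type) [Field k] [CharP k p]
      (n : ℕ) (σ : MvPolynomial (Fin n) k ≃ₐ[k] MvPolynomial (Fin n) k) (a b c d : Fin n),
      a ≠ b → a ≠ c → a ≠ d → b ≠ c → b ≠ d → c ≠ d →
      σ (X b) = X b + X a → σ (X c) = X c + X b → σ (X d) = X d + X c →
      (∀ i, i ≠ b → i ≠ c → i ≠ d → σ (X i) = X i) →
      Scheme.HasResolution
        (Spec (.of (FixedPoints.subalgebra k (MvPolynomial (Fin n) k) (Subgroup.zpowers σ))))) :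
    Summit.ResolutionOfSingularities.ResolutionOfSingularities.Theses.WildQuotients.JordanBlockFourfold := by
  refine jordanBlockFourfold_of_jordanFour fun p hp hp5 k _ _ _ n σ a b c d => ?_
  exact hJ4 p hp (hp₀.trans hp5) k n σ a b c d

end Summit.ResolutionOfSingularities.ResolutionOfSingularities.Theorems.WildQuotientResolution.JordanFour

end
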